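import Summits.Ventures.LatticeQCDFlow.Scaling.ReplicaExchangeFiniteSampler
import Literature.Probability.MarkovChains.BottleneckRatioSpectralGap
import Literature.Probability.MarkovChains.SpectralGapVariational

/-!
HONEST FRAMING: exact (Metropolis-corrected) sampling algorithms for lattice gauge theory; figures
of merit are autocorrelation/cost numbers at stated couplings and volumes; no continuum-physics
claim.

# ReplicaExchangeSectorFlow — A SWAP CAN MOVE A SECTOR-`A` CONFIGURATION BETWEEN REPLICAS BUT CANNOT CREATE ONE: THE
# STATIONARY FLOW INTO "SOME REPLICA IN `A`" IS AT MOST `((1−t)/(K+1))·Σ_k Q_k(Aᶜ,A)`, ITS COMPLEMENT HAS MASS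
# `Π_k μ_k(Aᶜ)`, HENCE `Gap ≤ 2(1−t)Σ_k Q_k(Aᶜ,A)/((K+1)·Π_k μ_k(Aᶜ))` WHEN `Π_k μ_k(Aᶜ) ≤ ½` (lean-2 GEN-17, ours)

Venture-side (OURS).  Cell `lqcd-flow` (pub-lqcd), unit `pub-lqcd-lean-2-g17`, 2026-08-25.  Setting of
`Scaling/ReplicaExchangeFiniteSampler` (chapter X): state `(τ, x)`, `x : Fin (K+1) → S`, target
`ptFinLaw μ (τ,x) = (K+1)⁻¹Π_k μ_k(x_k)`, sampler `P = ptFinSampler t μ M = t·ptFinSwap μ + (1−t)·ptFinUpdate M`.  For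
a set of configurations `A` (a topological sector) let `U_A = sectorHit A = {(τ,x) : ∃ k, x_k ∈ A}` ("some replica
holds a sector-`A` configuration").  Companion of `Scaling/SimulatedTemperingModeTorpid` §1 and of
`Scaling/ReplicaExchangeModeTorpid` (which used the sector COUNT); the hitting-time reading is docked in
`Scaling/ReplicaExchangeSectorHitting` via `Scaling/EquilibriumHittingFloor`.

## What is proved

* §1 `sectorHit`, `mem_sectorHit`, **`swapAct_mem_sectorHit`** — swaps permute replicas, so `U_A` and its complement
  are swap-invariant; `not_mem_sectorHit` (`(τ,x) ∉ U_A ↔ ∀ k, x_k ∉ A`).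
* §2 **`ptFin_edgeMeasure_swap_sectorHit`** — `Q_{Sw}(U_Aᶜ, U_A) = 0`.
* §3 `sum_sectorHit_update` — from a state with no replica in `A`, the update enters `U_A` with probability
  `Σ_k (K+1)⁻¹·M_k(x_k, A)`; **`ptFin_edgeMeasure_update_sectorHit_le`** —
  `Q_{Upd}(U_Aᶜ, U_A) ≤ (K+1)⁻¹·Σ_k Q_k(Aᶜ,A)` (drop the constraint on the other replicas, one-coordinate marginal).
* §4 **`ptFin_edgeMeasure_sectorHit_le`** — `Q_P(U_Aᶜ, U_A) ≤ ((1−t)/(K+1))·Σ_k Q_k(Aᶜ,A)`;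
  **`ptFin_mass_not_sectorHit`** — `π(U_Aᶜ) = Π_k μ_k(Aᶜ)`.
* §5 **`ptFin_spectralGap_le_sectorHit`** — if `0 < Π_k μ_k(Aᶜ) ≤ ½` then
  `Gap(P) ≤ 2(1−t)·Σ_k Q_k(Aᶜ,A)/((K+1)·Π_k μ_k(Aᶜ))` (Levin–Peres–Wilmer Thm 13.10 upper + Lemma 13.7, PROVED in the
  tree); **`ptFin_mixing_floor_sectorHit`** — `d(n) ≤ ¼ ⇒ Π_k μ_k(Aᶜ) ≤ 4n·((1−t)/(K+1))·Σ_k Q_k(Aᶜ,A)` (Thm 7.4).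

Reading (no numerics implied): when a sector is rare at every level of the ladder (`Π_k μ_k(Aᶜ)` not small) and
entered slowly by every within-replica update, replica exchange needs `≳ (K+1)Π_kμ_k(Aᶜ)/((1−t)ΣQ_k(Aᶜ,A))` steps to
relax — the swaps only redistribute sector-`A` configurations that the updates have produced.  NOT CLAIMED: the
hitting-time docking (separate file); anything measured.  Literature grade (cell rule): KNOWN MECHANISM (bottleneck
sets for swapping chains — Bhatnagar–Randall 2004, Woodard–Schmidler–Huber 2009), NEW TYPING; nothing cited as a fact;
no new bib keys.
-/

noncomputable section

open Finset Function
open Literature.Probability.MarkovChains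

namespace Summit.Ventures.LatticeQCDFlow.Scaling

variable {S : Type*} [Fintype S] [DecidableEq S] {K : ℕ} {μ : Fin (K + 1) → S → ℝ}
  {M : Fin (K + 1) → S → S → ℝ} {t : ℝ}

/-! ## §1 The set "some replica in `A`" -/

omit [DecidableEq S] in
/-- Summing `F(x)` against the replica-exchange target over all states gives the `π̃`-sum of `F` (local copy of the
identity in `Scaling/ReplicaExchangeModeTorpid`, which is not importable yet). [ours] -/
private theorem sum_ptFinLaw_mul_snd' (F : (Fin (K + 1) → S) → ℝ) :
    ∑ p : Fin (K + 1) × (Fin (K + 1) → S), ptFinLaw μ p * F p.2 = ∑ x, tensorFun μ x * F x := by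
  rw [Fintype.sum_prod_type]
  unfold ptFinLaw
  simp only
  rw [Finset.sum_const, Finset.card_univ, Fintype.card_fin, nsmul_eq_mul]
  rw [Finset.mul_sum]
  refine sum_congr rfl fun x _ => ?_
  push_cast
  field_simp


/-- `U_A = {(τ, x) : ∃ k, x_k ∈ A}`: some replica holds a configuration of the sector `A`. [ours] -/
def sectorHit (A : Finset S) : Finset (Fin (K + 1) × (Fin (K + 1) → S)) :=
  univ.filter fun p => ∃ k, p.2 k ∈ A

/-- Membership in `U_A`. [ours] -/
@[simp] theorem mem_sectorHit {A : Finset S} {p : Fin (K + 1) × (Fin (K + 1) → S)} :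
    p ∈ sectorHit A ↔ ∃ k, p.2 k ∈ A := by
  simp [sectorHit]

/-- `(τ,x) ∉ U_A ↔ ∀ k, x_k ∉ A`. [ours] -/
theorem not_mem_sectorHit {A : Finset S} {p : Fin (K + 1) × (Fin (K + 1) → S)} :
    p ∉ sectorHit A ↔ ∀ k, p.2 k ∉ A := by
  simp [sectorHit]

/-- **Swaps permute the replicas: `U_A` is swap-invariant.** [ours] -/
theorem swapAct_mem_sectorHit (A : Finset S) (j : Fin K) (p : Fin (K + 1) × (Fin (K + 1) → S)) :
    swapAct j p ∈ sectorHit A ↔ p ∈ sectorHit A := by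
  simp only [mem_sectorHit, swapAct, Function.comp_apply]
  constructor
  · rintro ⟨k, hk⟩; exact ⟨levelSwap j k, hk⟩
  · rintro ⟨k, hk⟩
    refine ⟨(levelSwap j).symm k, ?_⟩
    simpa using hk

/-! ## §2 The swap move cannot create a sector-`A` configuration -/

/-- **`Q_{Sw}(U_Aᶜ, U_A) = 0`.** [ours] -/
theorem ptFin_edgeMeasure_swap_sectorHit (hμ : ∀ k x, 0 < μ k x) (A : Finset S) :
    edgeMeasure (ptFinLaw μ) (ptFinSwap μ) (sectorHit A)ᶜ (sectorHit A) = 0 := by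
  unfold edgeMeasure
  refine Finset.sum_eq_zero fun p hp => Finset.sum_eq_zero fun q hq => ?_
  rw [Finset.mem_compl] at hp
  have hqp : q ≠ p := fun e => hp (e ▸ hq)
  rw [ptFinLaw_mul_ptFinSwap hμ hqp]
  unfold ptFinProposal
  rw [Finset.sum_mul]
  refine Finset.sum_eq_zero fun j _ => ?_
  split_ifs with hj
  · exfalso
    rw [hj, swapAct_mem_sectorHit] at hq
    exact hp hq
  · rw [zero_mul]

/-! ## §3 The update enters `U_A` one replica at a time -/

omit [Fintype S] [DecidableEq S] in
/-- From a state with no replica in `A`, the one-coordinate move `x ↦ x with x_k ← v` lands in `U_A` iff `v ∈ A`.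
[ours] -/
theorem update_mem_sector_iff {A : Finset S} {x : Fin (K + 1) → S} (hx : ∀ k, x k ∉ A) (k : Fin (K + 1)) (v : S) :
    (∃ i, update x k v i ∈ A) ↔ v ∈ A := by
  constructor
  · rintro ⟨i, hi⟩
    by_cases hik : i = k
    · subst hik; rwa [update_self] at hi
    · rw [update_of_ne hik] at hi; exact absurd hi (hx i)
  · intro hv; exact ⟨k, by rwa [update_self]⟩

/-- **From `(τ, x)` with no replica in `A`, the replica update enters `U_A` with probability
`Σ_k (K+1)⁻¹·Σ_{v ∈ A} M_k(x_k, v)`.** [ours] -/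
theorem sum_sectorHit_update {A : Finset S} {p : Fin (K + 1) × (Fin (K + 1) → S)} (hp : p ∉ sectorHit A) :
    ∑ q ∈ sectorHit A, ptFinUpdate M p q = ∑ k, (1 : ℝ) / (K + 1) * ∑ v ∈ A, M k (p.2 k) v := by
  rw [not_mem_sectorHit] at hp
  unfold sectorHit
  rw [Finset.sum_filter, Fintype.sum_prod_type]
  simp_rw [ptFinUpdate_apply]
  -- only the tag block `τ = p.1` contributes
  rw [Finset.sum_eq_single p.1 (fun τ _ hτ => by
      refine Finset.sum_eq_zero fun y _ => ?_
      have : ¬ ((τ, y) : Fin (K + 1) × (Fin (K + 1) → S)).1 = p.1 := hτ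
      simp [this]) (fun h => absurd (mem_univ _) h)]
  simp only [if_true]
  -- `Σ_y [∃ k, y_k ∈ A]·P̃(x,y)` via the one-coordinate structure of the product chain
  have h := sum_prodKernel_mul M (fun _ : Fin (K + 1) => (1 : ℝ) / (K + 1)) p.2
    (fun y => if (∃ k, y k ∈ A) then (1 : ℝ) else 0)
  have hl : ∑ y, (if (∃ k, y k ∈ A) then prodKernel (fun _ : Fin (K + 1) => (1 : ℝ) / (K + 1)) M p.2 y else 0)
      = ∑ y, prodKernel (fun _ : Fin (K + 1) => (1 : ℝ) / (K + 1)) M p.2 y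
          * (if (∃ k, y k ∈ A) then (1 : ℝ) else 0) :=
    sum_congr rfl fun y _ => by split_ifs <;> simp
  rw [hl, h]
  refine sum_congr rfl fun k _ => ?_
  congr 1
  have e3 : ∑ v, M k (p.2 k) v * (if ∃ i, update p.2 k v i ∈ A then (1 : ℝ) else 0)
      = ∑ v, (if v ∈ A then M k (p.2 k) v else 0) := by
    refine sum_congr rfl fun v _ => ?_
    rw [if_congr (update_mem_sector_iff hp k v) rfl rfl]
    split_ifs <;> simp
  rw [e3, Finset.sum_ite_mem, Finset.univ_inter]

/-- **The update flow into `U_A` from its complement is at most `(K+1)⁻¹·Σ_k Q_k(Aᶜ,A)`:** drop the constraint that the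
OTHER replicas avoid `A`, then take the one-coordinate marginal. [ours] -/
theorem ptFin_edgeMeasure_update_sectorHit_le (hμ : ∀ k x, 0 < μ k x) (hμ1 : ∀ k, ∑ u, μ k u = 1)
    (hM : ∀ k, IsRowStochastic (M k)) (A : Finset S) :
    edgeMeasure (ptFinLaw μ) (ptFinUpdate M) (sectorHit A)ᶜ (sectorHit A)
      ≤ (1 : ℝ) / (K + 1) * ∑ k, edgeMeasure (μ k) (M k) Aᶜ A := by
  unfold edgeMeasure
  -- inner sum: the entrance probability
  have h1 : ∑ p ∈ (sectorHit A)ᶜ, ∑ q ∈ sectorHit A, ptFinLaw μ p * ptFinUpdate M p q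
      = ∑ p ∈ (sectorHit A)ᶜ, ptFinLaw μ p * ∑ k, (1 : ℝ) / (K + 1) * ∑ v ∈ A, M k (p.2 k) v := by
    refine sum_congr rfl fun p hp => ?_
    rw [← Finset.mul_sum, sum_sectorHit_update (M := M) (Finset.mem_compl.mp hp)]
  rw [h1]
  -- enlarge the outer set coordinate by coordinate
  have h2 : ∀ k : Fin (K + 1), ∑ p ∈ (sectorHit (K := K) A)ᶜ, ptFinLaw μ p * ∑ v ∈ A, M k (p.2 k) v
      ≤ ∑ p : Fin (K + 1) × (Fin (K + 1) → S), ptFinLaw μ p * ((if p.2 k ∈ A then 0 else 1) * ∑ v ∈ A, M k (p.2 k) v) := by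
    intro k
    rw [← Finset.sum_filter_add_sum_filter_not univ (fun p : Fin (K + 1) × (Fin (K + 1) → S) => p ∈ sectorHit A)]
    have hzero : ∑ p ∈ univ.filter (fun p : Fin (K + 1) × (Fin (K + 1) → S) => p ∈ sectorHit A),
        ptFinLaw μ p * ((if p.2 k ∈ A then 0 else 1) * ∑ v ∈ A, M k (p.2 k) v) ≥ 0 :=
      sum_nonneg fun p _ => mul_nonneg (ptFinLaw_pos hμ p).le (mul_nonneg (by split_ifs <;> norm_num)
        (sum_nonneg fun v _ => (hM k).1 _ _))
    have hcompl : (sectorHit (K := K) A)ᶜ = univ.filter (fun p : Fin (K + 1) × (Fin (K + 1) → S) => ¬ p ∈ sectorHit A) := by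
      ext p; simp
    rw [hcompl]
    have heq : ∑ p ∈ univ.filter (fun p : Fin (K + 1) × (Fin (K + 1) → S) => ¬ p ∈ sectorHit A),
        ptFinLaw μ p * ((if p.2 k ∈ A then 0 else 1) * ∑ v ∈ A, M k (p.2 k) v)
        = ∑ p ∈ univ.filter (fun p : Fin (K + 1) × (Fin (K + 1) → S) => ¬ p ∈ sectorHit A),
          ptFinLaw μ p * ∑ v ∈ A, M k (p.2 k) v := by
      refine sum_congr rfl fun p hp => ?_
      have hpk : p.2 k ∉ A := (not_mem_sectorHit.mp (Finset.mem_filter.mp hp).2) k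
      rw [if_neg hpk, one_mul]
    rw [← heq]
    linarith
  -- the one-coordinate marginal of each enlarged sum
  have h3 : ∀ k : Fin (K + 1), ∑ p : Fin (K + 1) × (Fin (K + 1) → S),
      ptFinLaw μ p * ((if p.2 k ∈ A then 0 else 1) * ∑ v ∈ A, M k (p.2 k) v)
      = ∑ u ∈ Aᶜ, ∑ v ∈ A, μ k u * M k u v := by
    intro k
    rw [sum_ptFinLaw_mul_snd' (μ := μ) (fun x => (if x k ∈ A then (0 : ℝ) else 1) * ∑ v ∈ A, M k (x k) v),
      sum_tensorFun_mul_apply μ hμ1 k (fun u => (if u ∈ A then (0 : ℝ) else 1) * ∑ v ∈ A, M k u v)]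
    have e2 : ∑ u, μ k u * ((if u ∈ A then (0 : ℝ) else 1) * ∑ v ∈ A, M k u v) = ∑ u ∈ Aᶜ, ∑ v ∈ A, μ k u * M k u v := by
      rw [← Finset.sum_filter_add_sum_filter_not univ (fun u : S => u ∈ A)]
      have hz : ∑ u ∈ univ.filter (fun u : S => u ∈ A), μ k u * ((if u ∈ A then (0 : ℝ) else 1) * ∑ v ∈ A, M k u v) = 0 :=
        Finset.sum_eq_zero fun u hu => by rw [if_pos (Finset.mem_filter.mp hu).2]; ring
      rw [hz, zero_add]
      have hc : univ.filter (fun u : S => ¬ u ∈ A) = Aᶜ := by ext u; simp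
      rw [hc]
      refine sum_congr rfl fun u hu => ?_
      rw [if_neg (Finset.mem_compl.mp hu), one_mul, Finset.mul_sum]
    rw [e2]
  -- assemble
  calc ∑ p ∈ (sectorHit A)ᶜ, ptFinLaw μ p * ∑ k, (1 : ℝ) / (K + 1) * ∑ v ∈ A, M k (p.2 k) v
      = (1 : ℝ) / (K + 1) * ∑ k, ∑ p ∈ (sectorHit A)ᶜ, ptFinLaw μ p * ∑ v ∈ A, M k (p.2 k) v := by
        have eA : ∑ p ∈ (sectorHit A)ᶜ, ptFinLaw μ p * ∑ k, (1 : ℝ) / (K + 1) * ∑ v ∈ A, M k (p.2 k) v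
            = ∑ p ∈ (sectorHit A)ᶜ, ∑ k, (1 : ℝ) / (K + 1) * (ptFinLaw μ p * ∑ v ∈ A, M k (p.2 k) v) :=
          sum_congr rfl fun p _ => by rw [Finset.mul_sum]; exact sum_congr rfl fun k _ => by ring
        rw [eA, Finset.sum_comm, Finset.mul_sum]
        exact sum_congr rfl fun k _ => by rw [Finset.mul_sum]
    _ ≤ (1 : ℝ) / (K + 1) * ∑ k, ∑ u ∈ Aᶜ, ∑ v ∈ A, μ k u * M k u v := by
        refine mul_le_mul_of_nonneg_left (sum_le_sum fun k _ => ?_) (by positivity)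
        exact (h2 k).trans (le_of_eq (h3 k))

/-! ## §4 The sampler's flow into `U_A` and the mass of its complement -/

/-- **`Q_P(U_Aᶜ, U_A) ≤ ((1−t)/(K+1))·Σ_k Q_k(Aᶜ,A)`** (`0 ≤ t`). [ours] -/
theorem ptFin_edgeMeasure_sectorHit_le (hμ : ∀ k x, 0 < μ k x) (hμ1 : ∀ k, ∑ u, μ k u = 1)
    (hM : ∀ k, IsRowStochastic (M k)) (ht1 : t ≤ 1) (A : Finset S) :
    edgeMeasure (ptFinLaw μ) (ptFinSampler t μ M) (sectorHit A)ᶜ (sectorHit A)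
      ≤ (1 - t) / (K + 1) * ∑ k, edgeMeasure (μ k) (M k) Aᶜ A := by
  have hlin : edgeMeasure (ptFinLaw μ) (ptFinSampler t μ M) (sectorHit A)ᶜ (sectorHit A)
      = t * edgeMeasure (ptFinLaw μ) (ptFinSwap μ) (sectorHit A)ᶜ (sectorHit A)
        + (1 - t) * edgeMeasure (ptFinLaw μ) (ptFinUpdate M) (sectorHit A)ᶜ (sectorHit A) := by
    unfold edgeMeasure
    rw [Finset.mul_sum, Finset.mul_sum, ← Finset.sum_add_distrib]
    refine sum_congr rfl fun p _ => ?_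
    rw [Finset.mul_sum, Finset.mul_sum, ← Finset.sum_add_distrib]
    refine sum_congr rfl fun q _ => ?_
    rw [ptFinSampler_apply]
    ring
  rw [hlin, ptFin_edgeMeasure_swap_sectorHit hμ, mul_zero, zero_add, div_eq_mul_one_div, mul_assoc]
  exact mul_le_mul_of_nonneg_left (ptFin_edgeMeasure_update_sectorHit_le hμ hμ1 hM A) (by linarith)

/-- **`π(U_Aᶜ) = Π_k μ_k(Aᶜ)`:** no replica in `A` is a product event. [ours] -/
theorem ptFin_mass_not_sectorHit (A : Finset S) :
    ∑ p ∈ (sectorHit (K := K) A)ᶜ, ptFinLaw μ p = ∏ k : Fin (K + 1), ∑ u ∈ Aᶜ, μ k u := by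
  have hcompl : (sectorHit (K := K) A)ᶜ
      = univ.filter (fun p : Fin (K + 1) × (Fin (K + 1) → S) => ∀ k, p.2 k ∉ A) := by
    ext p; simp [sectorHit]
  rw [hcompl, Finset.sum_filter]
  have hF : ∀ p : Fin (K + 1) × (Fin (K + 1) → S), (if (∀ k, p.2 k ∉ A) then ptFinLaw μ p else 0)
      = ptFinLaw μ p * (if (∀ k, p.2 k ∉ A) then (1 : ℝ) else 0) := fun p => by split_ifs <;> simp
  simp_rw [hF]
  rw [sum_ptFinLaw_mul_snd' (μ := μ) (fun x => if (∀ k, x k ∉ A) then (1 : ℝ) else 0)]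
  -- `Σ_x [∀k, x_k ∉ A] π̃(x) = Π_k μ_k(Aᶜ)` : the indicator is a tensor product
  have hind : ∀ x : Fin (K + 1) → S, tensorFun μ x * (if (∀ k, x k ∉ A) then (1 : ℝ) else 0)
      = tensorFun (fun k u => if u ∈ A then 0 else μ k u) x := by
    intro x
    by_cases hx : ∀ k, x k ∉ A
    · rw [if_pos hx, mul_one]
      unfold tensorFun
      exact Finset.prod_congr rfl fun k _ => by simp [hx k]
    · rw [if_neg hx, mul_zero]
      push Not at hx
      obtain ⟨k, hk⟩ := hx
      unfold tensorFun
      exact (Finset.prod_eq_zero (mem_univ k) (by simp [hk])).symm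
  simp_rw [hind]
  rw [sum_tensorFun]
  refine Finset.prod_congr rfl fun k _ => ?_
  rw [← Finset.sum_filter_add_sum_filter_not univ (fun u : S => u ∈ A)]
  have hz : ∑ u ∈ univ.filter (fun u : S => u ∈ A), (if u ∈ A then (0 : ℝ) else μ k u) = 0 :=
    Finset.sum_eq_zero fun u hu => by rw [if_pos (Finset.mem_filter.mp hu).2]
  rw [hz, zero_add]
  have hc : univ.filter (fun u : S => ¬ u ∈ A) = Aᶜ := by ext u; simp
  rw [hc]
  exact sum_congr rfl fun u hu => by rw [if_neg (Finset.mem_compl.mp hu)]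

/-! ## §5 The spectral-gap ceiling and the mixing-time floor -/

/-- **`Gap(P) ≤ 2(1−t)·Σ_k Q_k(Aᶜ,A)/((K+1)·Π_k μ_k(Aᶜ))` whenever `0 < Π_k μ_k(Aᶜ) ≤ ½`** (`K ≥ 1`, `0 ≤ t ≤ 1`):
Levin–Peres–Wilmer Theorem 13.10 (upper) for the set "no replica in `A`", whose bottleneck ratio is at most
`(1−t)ΣQ_k(Aᶜ,A)/((K+1)Π_kμ_k(Aᶜ))` (by stationarity `Q(U_Aᶜ,U_A) = Q(U_A,U_Aᶜ)`). [ours] -/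
theorem ptFin_spectralGap_le_sectorHit (hK : 1 ≤ K) (hμ : ∀ k x, 0 < μ k x) (hμ1 : ∀ k, ∑ u, μ k u = 1)
    (hM : ∀ k, IsRowStochastic (M k)) (hMrev : ∀ k, DetailedBalance (μ k) (M k)) (ht0 : 0 ≤ t) (ht1 : t ≤ 1)
    (A : Finset S) (hP0 : 0 < ∏ k : Fin (K + 1), ∑ u ∈ Aᶜ, μ k u)
    (hPhalf : ∏ k : Fin (K + 1), ∑ u ∈ Aᶜ, μ k u ≤ 1 / 2) :
    spectralGap (ptFinLaw μ) (ptFinSampler t μ M)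
      ≤ 2 * ((1 - t) / (K + 1) * (∑ k, edgeMeasure (μ k) (M k) Aᶜ A) / ∏ k : Fin (K + 1), ∑ u ∈ Aᶜ, μ k u) := by
  haveI : Nonempty S := ⟨Classical.choice (by
    by_contra h
    rw [not_nonempty_iff] at h
    have := hμ1 0
    rw [Finset.univ_eq_empty, Finset.sum_empty] at this
    exact zero_ne_one this)⟩
  haveI : Nontrivial (Fin (K + 1)) := Fin.nontrivial_iff_two_le.mpr (by omega)
  have hP := ptFinSampler_isRowStochastic (M := M) hμ hM ht0 ht1
  have hDB := ptFinSampler_detailedBalance (t := t) (M := M) hμ hMrev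
  have hst : IsStationary (ptFinLaw μ) (ptFinSampler t μ M) := hDB.isStationary hP.2
  have hπ1 := sum_ptFinLaw (K := K) hμ1
  have hmass := ptFin_mass_not_sectorHit (K := K) (μ := μ) A
  have hS0 : 0 < ∑ p ∈ (sectorHit (K := K) A)ᶜ, ptFinLaw μ p := by rw [hmass]; exact hP0
  have hS : ∑ p ∈ (sectorHit (K := K) A)ᶜ, ptFinLaw μ p ≤ 1 / 2 := by rw [hmass]; exact hPhalf
  rw [LevinPeres2017_lemma_13_7 (ptFinLaw_pos hμ) hπ1 hP hDB]
  refine (LevinPeres2017_thm_13_10_upper_set hP hst (fun p => (ptFinLaw_pos hμ p).le) hπ1 hS0 hS).trans ?_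
  refine mul_le_mul_of_nonneg_left ?_ (by norm_num)
  unfold bottleneckRatio
  rw [hmass, compl_compl]
  exact div_le_div_of_nonneg_right (ptFin_edgeMeasure_sectorHit_le hμ hμ1 hM ht1 A) hP0.le

/-- **Mixing-time floor (Levin–Peres–Wilmer Theorem 7.4):** if `d(n) ≤ ¼` then
`Π_k μ_k(Aᶜ) ≤ 4n·((1−t)/(K+1))·Σ_k Q_k(Aᶜ,A)` (for `0 < Π_k μ_k(Aᶜ) ≤ ½`). [ours] -/
theorem ptFin_mixing_floor_sectorHit (hμ : ∀ k x, 0 < μ k x) (hμ1 : ∀ k, ∑ u, μ k u = 1)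
    (hM : ∀ k, IsRowStochastic (M k)) (hMrev : ∀ k, DetailedBalance (μ k) (M k)) (ht0 : 0 ≤ t) (ht1 : t ≤ 1)
    (A : Finset S) (hP0 : 0 < ∏ k : Fin (K + 1), ∑ u ∈ Aᶜ, μ k u)
    (hPhalf : ∏ k : Fin (K + 1), ∑ u ∈ Aᶜ, μ k u ≤ 1 / 2) {n : ℕ}
    (hn : worstTvDist (ptFinSampler t μ M) (ptFinLaw μ) n ≤ 1 / 4) :
    ∏ k : Fin (K + 1), ∑ u ∈ Aᶜ, μ k u ≤ 4 * n * ((1 - t) / (K + 1) * ∑ k, edgeMeasure (μ k) (M k) Aᶜ A) := by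
  have hP := ptFinSampler_isRowStochastic (M := M) hμ hM ht0 ht1
  have hDB := ptFinSampler_detailedBalance (t := t) (M := M) hμ hMrev
  have hst : IsStationary (ptFinLaw μ) (ptFinSampler t μ M) := hDB.isStationary hP.2
  have hπ1 := sum_ptFinLaw (K := K) hμ1
  have hmass := ptFin_mass_not_sectorHit (K := K) (μ := μ) A
  have hS0 : 0 < ∑ p ∈ (sectorHit (K := K) A)ᶜ, ptFinLaw μ p := by rw [hmass]; exact hP0
  have hS : ∑ p ∈ (sectorHit (K := K) A)ᶜ, ptFinLaw μ p ≤ 1 / 2 := by rw [hmass]; exact hPhalf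
  have h := LevinPeres2017_thm_7_4_set hP hst (fun p => (ptFinLaw_pos hμ p).le) hπ1 hS0 hS hn
  unfold bottleneckRatio at h
  rw [hmass, compl_compl] at h
  -- `1 ≤ 4n·Q/Π`, `Q ≤ bound` ⇒ `Π ≤ 4n·bound`
  have hQ := ptFin_edgeMeasure_sectorHit_le (t := t) hμ hμ1 hM ht1 A
  have h1 : ∏ k : Fin (K + 1), ∑ u ∈ Aᶜ, μ k u
      ≤ 4 * n * edgeMeasure (ptFinLaw μ) (ptFinSampler t μ M) (sectorHit A)ᶜ (sectorHit A) := by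
    have := mul_le_mul_of_nonneg_right h hP0.le
    have e : 4 * (n : ℝ) * (edgeMeasure (ptFinLaw μ) (ptFinSampler t μ M) (sectorHit A)ᶜ (sectorHit A)
        / ∏ k : Fin (K + 1), ∑ u ∈ Aᶜ, μ k u) * ∏ k : Fin (K + 1), ∑ u ∈ Aᶜ, μ k u
        = 4 * n * edgeMeasure (ptFinLaw μ) (ptFinSampler t μ M) (sectorHit A)ᶜ (sectorHit A) := by
      field_simp
    rw [one_mul, e] at this
    exact this
  exact h1.trans (mul_le_mul_of_nonneg_left hQ (by positivity))

end Summit.Ventures.LatticeQCDFlow.Scaling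

end
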